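import Mathlib
import Literature.Computability.AlgebraicComplexity.GroupTheoreticMatMul
import Literature.Barriers.MatrixMultiplication.TricoloredSumFreeBarrier
import Summits.MatrixMultiplication.MatrixMultiplication.Theorems.GroupTheoreticSTPPCThesisPackingSumset

/-!
# Per-member packing slack for STPP families in finite abelian groups (U11-min)

Support file for route `MatrixMultiplication/GroupTheoreticSTPP`, negative crux
`stmt-MatrixMultiplication-0596` (`CAbelianObstructionNeg`): finite-range evidence — part 1 of the kernel
form of the cell mm-stpp rules **U11-min** (per-member Theorem A, this file) and **U11-Δ** (second-moment
slack rule, sequel file `…SecondMoment.lean`), HOME/mm-stpp-lit/KNESER-KILLS.md §1, §4.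

Setting: `(A i, B i, C i)_{i < N}` an STPP family (tree predicate `IsSTPP`, CKSU 2005 Def. 5.1 in the
additive form of BCCGNSU 2017 §3.1) with all sets non-empty in a finite abelian group `H`, `M = |H|`.
Difference sets `X = ⋃ (A i − B i)`, `Y = ⋃ (B i − C i)`, `Z = ⋃ (A i − C i)`; by the STPP clause these are
disjoint unions with `|X| = Σ aᵢbᵢ`, `|Y| = Σ bᵢcᵢ`, `|Z| = Σ aᵢcᵢ` (`card_X/Y/Z`; the `X` facts are
eng-1's `STPPPackingSumset.card_sub_eq` / `disjoint_sub_sub`, p404150).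

* `vadd_Y_inter_Z_subset`: for `x₀ = s' − t ∈ A i − B i`, `(x₀ + Y) ∩ Z ⊆ {s' − u' : u' ∈ C i}` — the STPP
  clause read once.  Hence **U11-min** (`slack_C`): `Σ bc + Σ ca ≤ M + cᵢ` for EVERY member `i`
  (the tree's `stpp_neumann_packing`, p402899, has `+ m` with `m ≥` every `cᵢ`; Kemperman–Scherk shape).
* Rotations `slack_A`, `slack_B` via the tree's `IsSTPP.rotate`.

WHAT THIS IS NOT: necessary conditions only (no STPP family is constructed, no `ω` statement); the rules
are silent on the CKSU Prop. 5.2 pairs and on every known STPP object.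

## References
* H. Cohn, R. Kleinberg, B. Szegedy, C. Umans, FOCS 2005, Def. 5.1 (STPP).
* J. H. B. Kemperman, Indag. Math. 18 (1956) 247–254; P. Scherk, Amer. Math. Monthly 62 (1955) 46–47
  (the `|X + Y| ≥ |X| + |Y| − r` shape of U11-min).
* P. M. Neumann, LMS J. Comput. Math. 14 (2011), Obs. 3.1 (one triple).
-/

-- single-conjunct summit: the mandated namespace repeats `MatrixMultiplication`.
set_option linter.dupNamespace false

namespace Summit.MatrixMultiplication.MatrixMultiplication.Theorems

namespace STPPSlack

open Finset Literature.Computability.AlgebraicComplexity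
open scoped Pointwise

variable {H : Type*} [AddCommGroup H] [DecidableEq H] {N : ℕ} {A B C : Fin N → Finset H}

/-! ### The three difference sets are disjoint unions -/

omit [DecidableEq H] in
/-- `Y`-injectivity: `t' − u = t'' − u''` with `t' ∈ B j`, `u ∈ C j`, `t'' ∈ B j'`, `u'' ∈ C j'` forces
`j = j'`, `t' = t''`, `u = u''` (the STPP clause with `s = s' ∈ A j'`). [original] -/
theorem sub_BC_inj (h : IsSTPP A B C) {j j' : Fin N} (hA : (A j').Nonempty) {t' u t'' u'' : H}
    (ht' : t' ∈ B j) (hu : u ∈ C j) (ht'' : t'' ∈ B j') (hu'' : u'' ∈ C j')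
    (he : t' - u = t'' - u'') : j = j' ∧ t' = t'' ∧ u = u'' := by
  obtain ⟨s, hs⟩ := hA
  have key : (s - s) + (t' - t'') + (u'' - u) = 0 := by
    have : (s - s) + (t' - t'') + (u'' - u) = (t' - u) - (t'' - u'') := by abel
    rw [this, he, sub_self]
  obtain ⟨h1, -, -, h4, h5⟩ := h j' j j' s hs s hs t'' ht'' t' ht' u hu u'' hu'' key
  exact ⟨h1.symm, h4.symm, h5⟩

omit [DecidableEq H] in
/-- `Z`-injectivity: `s − u' = s'' − u''` with `s ∈ A k`, `u' ∈ C k`, `s'' ∈ A k'`, `u'' ∈ C k'` forces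
`k = k'`, `s = s''`, `u' = u''` (the STPP clause with `t = t' ∈ B k'`). [original] -/
theorem sub_AC_inj (h : IsSTPP A B C) {k k' : Fin N} (hB : (B k').Nonempty) {s u' s'' u'' : H}
    (hs : s ∈ A k) (hu' : u' ∈ C k) (hs'' : s'' ∈ A k') (hu'' : u'' ∈ C k')
    (he : s - u' = s'' - u'') : k = k' ∧ s = s'' ∧ u' = u'' := by
  obtain ⟨t, ht⟩ := hB
  have key : (s'' - s) + (t - t) + (u' - u'') = 0 := by
    have : (s'' - s) + (t - t) + (u' - u'') = (s'' - u'') - (s - u') := by abel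
    rw [this, he, sub_self]
  obtain ⟨-, h2, h3, -, h5⟩ := h k' k' k s hs s'' hs'' t ht t ht u'' hu'' u' hu' key
  exact ⟨h2.symm, h3, h5.symm⟩

/-- `|B j − C j| = |B j| |C j|` (needs `A j ≠ ∅`). [original] -/
theorem card_sub_BC (h : IsSTPP A B C) (j : Fin N) (hA : (A j).Nonempty) :
    (B j - C j).card = (B j).card * (C j).card := by
  rw [← image_sub_product, ← card_product (B j) (C j)]
  refine card_image_of_injOn ?_
  rintro ⟨t', u⟩ hp ⟨t'', u''⟩ hq (he : t' - u = t'' - u'')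
  simp only [coe_product, Set.mem_prod, mem_coe] at hp hq
  obtain ⟨-, h2, h3⟩ := sub_BC_inj h hA hp.1 hp.2 hq.1 hq.2 he
  rw [h2, h3]

/-- `|A k − C k| = |A k| |C k|` (needs `B k ≠ ∅`). [original] -/
theorem card_sub_AC (h : IsSTPP A B C) (k : Fin N) (hB : (B k).Nonempty) :
    (A k - C k).card = (A k).card * (C k).card := by
  rw [← image_sub_product, ← card_product (A k) (C k)]
  refine card_image_of_injOn ?_
  rintro ⟨s, u'⟩ hp ⟨s'', u''⟩ hq (he : s - u' = s'' - u'')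
  simp only [coe_product, Set.mem_prod, mem_coe] at hp hq
  obtain ⟨-, h2, h3⟩ := sub_AC_inj h hB hp.1 hp.2 hq.1 hq.2 he
  rw [h2, h3]

/-- The `A i − B i` are pairwise disjoint (needs all `C i ≠ ∅`; eng-1's `disjoint_sub_sub`, p404150).
[original] -/
theorem pairwiseDisjoint_sub_AB (h : IsSTPP A B C) (hC : ∀ i, (C i).Nonempty) :
    ((univ : Finset (Fin N)) : Set (Fin N)).PairwiseDisjoint fun i => A i - B i :=
  fun _ _ i' _ hne => STPPPackingSumset.disjoint_sub_sub h hne (hC i')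

/-- The `B j − C j` are pairwise disjoint (needs all `A j ≠ ∅`). [original] -/
theorem pairwiseDisjoint_sub_BC (h : IsSTPP A B C) (hA : ∀ i, (A i).Nonempty) :
    ((univ : Finset (Fin N)) : Set (Fin N)).PairwiseDisjoint fun j => B j - C j := by
  intro j _ j' _ hne
  rw [Function.onFun, disjoint_left]
  intro x hx hx'
  rw [mem_sub] at hx hx'
  obtain ⟨t', ht', u, hu, rfl⟩ := hx
  obtain ⟨t'', ht'', u'', hu'', he⟩ := hx'
  exact hne (sub_BC_inj h (hA j') ht' hu ht'' hu'' he.symm).1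

/-- The `A k − C k` are pairwise disjoint (needs all `B k ≠ ∅`). [original] -/
theorem pairwiseDisjoint_sub_AC (h : IsSTPP A B C) (hB : ∀ i, (B i).Nonempty) :
    ((univ : Finset (Fin N)) : Set (Fin N)).PairwiseDisjoint fun k => A k - C k := by
  intro k _ k' _ hne
  rw [Function.onFun, disjoint_left]
  intro x hx hx'
  rw [mem_sub] at hx hx'
  obtain ⟨s, hs, u', hu', rfl⟩ := hx
  obtain ⟨s'', hs'', u'', hu'', he⟩ := hx'
  exact hne (sub_AC_inj h (hB k') hs hu' hs'' hu'' he.symm).1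

/-- `|X| = |⋃ (A i − B i)| = Σ |A i| |B i|`. [original] -/
theorem card_X (h : IsSTPP A B C) (hC : ∀ i, (C i).Nonempty) :
    (univ.biUnion fun i => A i - B i).card = ∑ i, (A i).card * (B i).card := by
  rw [card_biUnion (pairwiseDisjoint_sub_AB h hC)]
  exact sum_congr rfl fun i _ => STPPPackingSumset.card_sub_eq h i (hC i)

/-- `|Y| = |⋃ (B j − C j)| = Σ |B j| |C j|`. [original] -/
theorem card_Y (h : IsSTPP A B C) (hA : ∀ i, (A i).Nonempty) :
    (univ.biUnion fun j => B j - C j).card = ∑ i, (B i).card * (C i).card := by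
  rw [card_biUnion (pairwiseDisjoint_sub_BC h hA)]
  exact sum_congr rfl fun j _ => card_sub_BC h j (hA j)

/-- `|Z| = |⋃ (A k − C k)| = Σ |A k| |C k|`. [original] -/
theorem card_Z (h : IsSTPP A B C) (hB : ∀ i, (B i).Nonempty) :
    (univ.biUnion fun k => A k - C k).card = ∑ i, (A i).card * (C i).card := by
  rw [card_biUnion (pairwiseDisjoint_sub_AC h hB)]
  exact sum_congr rfl fun k _ => card_sub_AC h k (hB k)

/-! ### The STPP clause read once: `(x₀ + Y) ∩ Z` is small -/

/-- For `x₀ = s' − t` with `s' ∈ A i`, `t ∈ B i`, the translate `x₀ + Y` of `Y = ⋃ (B j − C j)` meets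
`Z = ⋃ (A k − C k)` only inside `{s' − u' : u' ∈ C i}`: if `(s' − t) + (t' − u) = s − u'` then the STPP
clause `(s' − s) + (t' − t) + (u' − u) = 0` forces `j = k = i`, `s = s'`, `u = u'`. [original] -/
theorem vadd_Y_inter_Z_subset (h : IsSTPP A B C) {i : Fin N} {s' t : H} (hs' : s' ∈ A i)
    (ht : t ∈ B i) :
    ((s' - t) +ᵥ univ.biUnion fun j => B j - C j) ∩ (univ.biUnion fun k => A k - C k) ⊆
      (C i).image fun u' => s' - u' := by
  intro z hz
  rw [mem_inter, mem_vadd_finset] at hz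
  obtain ⟨⟨y, hy, hyz⟩, hz'⟩ := hz
  rw [mem_biUnion] at hy hz'
  obtain ⟨j, -, hy⟩ := hy
  obtain ⟨k, -, hz'⟩ := hz'
  rw [mem_sub] at hy hz'
  obtain ⟨t', ht', u, hu, rfl⟩ := hy
  obtain ⟨s, hs, u', hu', rfl⟩ := hz'
  rw [vadd_eq_add] at hyz
  have he : (s' - s) + (t' - t) + (u' - u) = 0 := by
    have : (s' - s) + (t' - t) + (u' - u) = (s' - t) + (t' - u) - (s - u') := by abel
    rw [this, hyz, sub_self]
  obtain ⟨hij, hjk, hss, -, huu⟩ := h i j k s hs s' hs' t ht t' ht' u hu u' hu' he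
  rw [mem_image]
  refine ⟨u', ?_, by rw [hss]⟩
  rw [hij, hjk]; exact hu'

/-! ### U11-min: Theorem A per member -/

/-- **U11-min (per-member packing inequality, `C`-form).** For an STPP family with all sets non-empty in
a finite abelian group `H` and EVERY member `i`: `Σ_t |C t| (|A t| + |B t|) ≤ |H| + |C i|`.
(The tree's `stpp_neumann_packing`, p402899, is the case `|C i| ≤ m`; Kemperman–Scherk shape
`|x₀ + Y ∪ Z| = |Y| + |Z| − |(x₀ + Y) ∩ Z| ≤ |H|`.) [original] -/
theorem slack_C [Fintype H] (h : IsSTPP A B C) (hA : ∀ i, (A i).Nonempty)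
    (hB : ∀ i, (B i).Nonempty) (i : Fin N) :
    ∑ t, (C t).card * ((A t).card + (B t).card) ≤ Fintype.card H + (C i).card := by
  obtain ⟨s', hs'⟩ := hA i
  obtain ⟨t, ht⟩ := hB i
  set Y := univ.biUnion fun j => B j - C j with hYdef
  set Z := univ.biUnion fun k => A k - C k with hZdef
  have hY : ((s' - t) +ᵥ Y).card = ∑ t, (B t).card * (C t).card := by
    rw [card_vadd_finset]; exact card_Y h hA
  have hZ : Z.card = ∑ t, (A t).card * (C t).card := card_Z h hB
  have hint : (((s' - t) +ᵥ Y) ∩ Z).card ≤ (C i).card :=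
    (card_le_card (vadd_Y_inter_Z_subset h hs' ht)).trans card_image_le
  have hun : (((s' - t) +ᵥ Y) ∪ Z).card ≤ Fintype.card H := card_le_univ _
  have hui := card_union_add_card_inter ((s' - t) +ᵥ Y) Z
  have hsum : ∑ t, (C t).card * ((A t).card + (B t).card) =
      ∑ t, (B t).card * (C t).card + ∑ t, (A t).card * (C t).card := by
    rw [← sum_add_distrib]; exact sum_congr rfl fun t _ => by ring
  omega

/-- **U11-min, `A`-form** (rotation `(B, C, A)`): `Σ_t |A t| (|B t| + |C t|) ≤ |H| + |A i|` for every
member `i`. [original] -/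
theorem slack_A [Fintype H] (h : IsSTPP A B C) (hB : ∀ i, (B i).Nonempty)
    (hC : ∀ i, (C i).Nonempty) (i : Fin N) :
    ∑ t, (A t).card * ((B t).card + (C t).card) ≤ Fintype.card H + (A i).card :=
  slack_C h.rotate hB hC i

/-- **U11-min, `B`-form** (rotation `(C, A, B)`): `Σ_t |B t| (|C t| + |A t|) ≤ |H| + |B i|` for every
member `i`. [original] -/
theorem slack_B [Fintype H] (h : IsSTPP A B C) (hC : ∀ i, (C i).Nonempty)
    (hA : ∀ i, (A i).Nonempty) (i : Fin N) :
    ∑ t, (B t).card * ((C t).card + (A t).card) ≤ Fintype.card H + (B i).card :=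
  slack_C h.rotate.rotate hC hA i

end STPPSlack

end Summit.MatrixMultiplication.MatrixMultiplication.Theorems
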